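import Summits.Ventures.GridStability.Bench.DVOC2GCBD19Deg2AQ13
import Summits.Ventures.GridStability.Lyapunov.CertificateSoundness
import Summits.Ventures.GridStability.Lyapunov.PolyRecast
import Mathlib.Analysis.Calculus.Deriv.Pi
import Mathlib.Analysis.Normed.Module.FiniteDimension
import HarnessLib

/-!
# G3.c TRACK S «DVOC2-GCBD19-13»-roa — from the kernel-checked quotient certificate (deg 2, toolchain
# A ≡ D) to sublevel invariance and convergence of the rotation invariants FOR THE MODEL M′

Venture GRIDFUSION, `plan/PARTITION.md` A20 (RULING 18 Track S: «producer sos-3, A sos-1/certnum-sdp-3,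
B sos-2, Lean sos-5/sos-3, -roa lyap-1, model-side transport model-3»), A29 (object of record
«DVOC2-GCBD19-13», κ′-rounded plant, R-7 rider «Track S plant = Track T plant rotated by 6.2·10⁻⁷
rad»); seat gridfusion-lyap-1 (g3). Companion of the Bench file `Bench/DVOC2GCBD19Deg2AQ13{Data,}.lean`
(sos-3's emission of the claim instance `cert/sos-3/runs/j262640/DVOC2-GCBD19-13-deg2-instance.json`
438044cc744eb601 ≡ certnum-sdp-3's A file `DVOC2-GCBD19-13-deg2-A-sosgram.json`, lead 01:06:04Z;
polynomial content identical: `f`, `h̃`, `V`, `V̇`, level `2247/1000`, `ε_pos = 10⁻³`,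
`ε_dot = 10⁻⁴`), whose decls it uses VERBATIM (`deg2_A_q13_{f_*,h,V,Vdot}` + `_poly`, and the
two CERTIFIED identities `deg2_A_q13_{V_pos, Vdot_neg}`); the analysis is
`Lyapunov/{SublevelTrapping, CertificateSoundness, PolyRecast}.lean` (p459619 / p460300 / p482110:
the chain rule is the GENERIC route — `V̇_poly = lieDeriv f V_poly` by one `decide`).

SHAPE (= the hypothesis `hroa` of model-3's transport
`InverterDVOC.DvocNetwork.invariants_tendsto_of_quotient_roa`, `Models/InverterDVOCOrbitRoa.lean`):
the recast system is the SHIFTED ROTATION QUOTIENT `ẋ = G̃(x)` of the `N = 2` dVOC network,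
`x = (ρ₀, ρ₁, ξ, ζ) − r⋆`, `r⋆ = (1, 1, 16787363/16799845, 647484/16799845)` (model-3 p467971
invariants, model-4 instance-N2-13.json); the constraint set `M` = shifted quadric `{h̃ = 0}` ∩ the
orthant conjuncts `{ρ₀ ≥ 0} ∩ {ρ₁ ≥ 0}` of the certificate's domain, which the transport supplies
for ALL times (`ρ_k = ‖v̂_k‖²`), so — unlike the machine-angle Roa files — no first-integral
argument is needed here and the domain hypotheses of `Vdot_neg` are read off `M`. Compactness of the
certified piece comes from `V_pos` (`10⁻³·φ ≤ V ≤ 2247/1000` ⇒ `‖x‖∞ ≤ 48`).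

THREE COLUMNS. CERTIFIED (kernel, in the Bench file): on `{h̃ = 0}`: `V ≥ 10⁻³ φ`; on
`{h̃ = 0} ∩ {V ≤ 2247/1000} ∩ {ρ₀, ρ₁ ≥ 0}`: `V̇ ≤ −10⁻⁴ φ`, `φ = Σ xᵢ²`. MODELLED: every theorem of
THIS file is about the quotient ODE `ẋ = G̃(x)` of the reduced dVOC network `InverterDVOC.DvocNetwork 2`
[cite: GrossEtAl2019, §V-A; SuboticEtAl2021, eq. (ss.f.vhat)] at «DVOC2-GCBD19-13» (MODEL-VALIDITY
MV-6O + MV-κ(κ′) + MV-P + N2-restriction, model-2 00:00:53Z). VALIDATED: nothing. No sentence of this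
file says a converter or a grid is stable; the network-level reading («‖v̂_k‖² → ρ_k⋆, ⟨v̂₀,v̂₁⟩ → ξ⋆,
v̂₀ ∧ v̂₁ → ζ⋆» — convergence to the rest ORBIT) is model-3's corollary of `deg2_A_q13_roa` through
`rho_xi_zeta_tendsto_of_quotient_roa` (F-agreement with `quotField`, `hM` from
`invariants_mem_quadric` + `invariants_rho_nonneg`).
-/

namespace Summit.Ventures.GridStability.Bench.DVOC2GCBD19

open Set Filter Metric Topology Real
open Summit.Ventures.GridStability.Lyapunov
open Literature.Computation.Certificates Literature.Computation.Certificates.SOS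

noncomputable section

/-! ### Recast phase space `Fin 4 → ℝ`, coordinates in the certificate's variable order ['rho_0', 'rho_1', 'xi', 'zeta'] -/

/-- The recast field of the instance on `Fin 4 → ℝ` (components = the Bench decls verbatim).
MODELLED column. [folklore] -/
def deg2_A_q13_F (z : Fin 4 → ℝ) : Fin 4 → ℝ :=
  ![deg2_A_q13_f_rho_0 (z 0) (z 1) (z 2) (z 3),
    deg2_A_q13_f_rho_1 (z 0) (z 1) (z 2) (z 3),
    deg2_A_q13_f_xi (z 0) (z 1) (z 2) (z 3),
    deg2_A_q13_f_zeta (z 0) (z 1) (z 2) (z 3)]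

/-- The certificate's `V` on the phase space. [folklore] -/
def deg2_A_q13_Vz (z : Fin 4 → ℝ) : ℝ := deg2_A_q13_V (z 0) (z 1) (z 2) (z 3)

/-- Its Lie derivative `∇V·f` (the emitted `Vdot`). [folklore] -/
def deg2_A_q13_LVz (z : Fin 4 → ℝ) : ℝ := deg2_A_q13_Vdot (z 0) (z 1) (z 2) (z 3)

/-- The certified dissipation rate `W = ε_dot·φ`. [folklore] -/
def deg2_A_q13_Wz (z : Fin 4 → ℝ) : ℝ := ((1 : ℝ) / 10000) * ((1 : ℝ) * z 3 ^ 2 + (1 : ℝ) * z 2 ^ 2 + (1 : ℝ) * z 1 ^ 2 + (1 : ℝ) * z 0 ^ 2)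

/-- The constraint set `M` = the shifted quadric `{h = 0}` ∩ the orthant conjuncts of the
certificate's domain `{0 ≤ z 0 + 1} ∩ {0 ≤ z 1 + 1}` (`ρ_k = z_k + 1 = ‖v̂_k‖² ≥ 0` along every network
solution — supplied for ALL times by model-3's transport, so no invariance argument is needed here).
[folklore] -/
def deg2_A_q13_M : Set (Fin 4 → ℝ) :=
  {z | deg2_A_q13_h (z 0) (z 1) (z 2) (z 3) = 0 ∧ 0 ≤ z 0 + 1 ∧ 0 ≤ z 1 + 1}

/-- The certificate's level `c = 2247/1000`. [folklore] -/
def deg2_A_q13_level : ℝ := ((2247 : ℝ) / 1000)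

/-- Component `0` (`rho_0`) of the recast field. [folklore] -/
@[simp] theorem deg2_A_q13_F_0 (z : Fin 4 → ℝ) : deg2_A_q13_F z 0 = deg2_A_q13_f_rho_0 (z 0) (z 1) (z 2) (z 3) := rfl
/-- Component `1` (`rho_1`) of the recast field. [folklore] -/
@[simp] theorem deg2_A_q13_F_1 (z : Fin 4 → ℝ) : deg2_A_q13_F z 1 = deg2_A_q13_f_rho_1 (z 0) (z 1) (z 2) (z 3) := rfl
/-- Component `2` (`xi`) of the recast field. [folklore] -/
@[simp] theorem deg2_A_q13_F_2 (z : Fin 4 → ℝ) : deg2_A_q13_F z 2 = deg2_A_q13_f_xi (z 0) (z 1) (z 2) (z 3) := rfl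
/-- Component `3` (`zeta`) of the recast field. [folklore] -/
@[simp] theorem deg2_A_q13_F_3 (z : Fin 4 → ℝ) : deg2_A_q13_F z 3 = deg2_A_q13_f_zeta (z 0) (z 1) (z 2) (z 3) := rfl

/-! ### Algebraic consequences of the certified identities -/

/-- Dissipation inequality in bridge form on `M ∩ {V ≤ c}`: `LV ≤ −W` (domain hypotheses of the
Bench theorem = the orthant conjuncts of `M`). CERTIFIED input: `deg2_A_q13_Vdot_neg`. [folklore] -/
theorem deg2_A_q13_LVz_le {z : Fin 4 → ℝ} (hz : z ∈ deg2_A_q13_M) (hV : deg2_A_q13_Vz z ≤ deg2_A_q13_level) :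
    deg2_A_q13_LVz z ≤ -deg2_A_q13_Wz z := by
  obtain ⟨hh, hdom0, hdom1⟩ := hz
  have h := deg2_A_q13_Vdot_neg (z 0) (z 1) (z 2) (z 3) hV (by have hb := hdom0; linarith)
    (by have hb := hdom1; linarith) hh
  simp only [deg2_A_q13_LVz, deg2_A_q13_Wz]
  linarith

/-- `W = ε·φ` is positive definite: its only zero is the origin. [folklore] -/
theorem deg2_A_q13_eq_zero_of_Wz {z : Fin 4 → ℝ} (hW : deg2_A_q13_Wz z = 0) : z = 0 := by
  simp only [deg2_A_q13_Wz] at hW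
  have e0 : z 0 = 0 := by nlinarith [sq_nonneg (z 0), sq_nonneg (z 1), sq_nonneg (z 2), sq_nonneg (z 3)]
  have e1 : z 1 = 0 := by nlinarith [sq_nonneg (z 0), sq_nonneg (z 1), sq_nonneg (z 2), sq_nonneg (z 3)]
  have e2 : z 2 = 0 := by nlinarith [sq_nonneg (z 0), sq_nonneg (z 1), sq_nonneg (z 2), sq_nonneg (z 3)]
  have e3 : z 3 = 0 := by nlinarith [sq_nonneg (z 0), sq_nonneg (z 1), sq_nonneg (z 2), sq_nonneg (z 3)]
  funext i
  fin_cases i <;> simp [e0, e1, e2, e3]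

/-- Strictness on every level surface `{V = γ}`, `γ > 0`: `W > 0` there. [folklore] -/
theorem deg2_A_q13_Wz_pos {z : Fin 4 → ℝ} {γ : ℝ} (hγ0 : 0 < γ) (hV : deg2_A_q13_Vz z = γ) :
    0 < deg2_A_q13_Wz z := by
  have hW0 : 0 ≤ deg2_A_q13_Wz z := by simp only [deg2_A_q13_Wz]; positivity
  rcases hW0.lt_or_eq with h | h
  · exact h
  · exfalso
    have hz0 := deg2_A_q13_eq_zero_of_Wz h.symm
    subst hz0
    simp [deg2_A_q13_Vz, deg2_A_q13_V_eq] at hV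
    linarith

/-- `M` is closed (a level set and two closed half-spaces). [folklore] -/
theorem deg2_A_q13_isClosed_M : IsClosed deg2_A_q13_M := by
  have h1 : IsClosed {z : Fin 4 → ℝ | deg2_A_q13_h (z 0) (z 1) (z 2) (z 3) = 0} := by
    simp only [deg2_A_q13_h_eq]
    exact isClosed_eq (by fun_prop) continuous_const
  have h2 : IsClosed {z : Fin 4 → ℝ | 0 ≤ z 0 + 1} := isClosed_le continuous_const (by fun_prop)
  have h3 : IsClosed {z : Fin 4 → ℝ | 0 ≤ z 1 + 1} := isClosed_le continuous_const (by fun_prop)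
  have : deg2_A_q13_M = {z : Fin 4 → ℝ | deg2_A_q13_h (z 0) (z 1) (z 2) (z 3) = 0} ∩
      ({z : Fin 4 → ℝ | 0 ≤ z 0 + 1} ∩ {z : Fin 4 → ℝ | 0 ≤ z 1 + 1}) := by
    ext z; simp [deg2_A_q13_M]
  rw [this]
  exact h1.inter (h2.inter h3)

/-- Compactness of the certified piece `S = {z ∈ M | V z ≤ c}` (closed; bounded by
`V_pos`: `‖z‖∞ ≤ 48`). [folklore] -/
theorem deg2_A_q13_isCompact_S : IsCompact {z ∈ deg2_A_q13_M | deg2_A_q13_Vz z ≤ deg2_A_q13_level} := by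
  have hMc : IsClosed deg2_A_q13_M := deg2_A_q13_isClosed_M
  have hVc : Continuous deg2_A_q13_Vz := by
    unfold deg2_A_q13_Vz; simp only [deg2_A_q13_V_eq]; fun_prop
  have h := isCompact_sublevel_of_norm_le (D := univ) (c := deg2_A_q13_level) (R := (48 : ℝ)) hMc
    isClosed_univ hVc.continuousOn ?_
  · rwa [inter_univ] at h
  rintro z ⟨hz, -⟩ hV
  have hball := deg2_A_q13_V_pos (z 0) (z 1) (z 2) (z 3) hz.1
  have hlev : deg2_A_q13_Vz z ≤ ((2247 : ℝ) / 1000) := by simpa only [deg2_A_q13_level] using hV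
  simp only [deg2_A_q13_Vz] at hlev
  have hb0 : |z 0| ≤ (48 : ℝ) :=
    abs_le.2 (abs_le_of_sq_le_sq' (by nlinarith [hball, hlev, sq_nonneg (z 1), sq_nonneg (z 2), sq_nonneg (z 3)]) (by norm_num))
  have hb1 : |z 1| ≤ (48 : ℝ) :=
    abs_le.2 (abs_le_of_sq_le_sq' (by nlinarith [hball, hlev, sq_nonneg (z 0), sq_nonneg (z 2), sq_nonneg (z 3)]) (by norm_num))
  have hb2 : |z 2| ≤ (48 : ℝ) :=
    abs_le.2 (abs_le_of_sq_le_sq' (by nlinarith [hball, hlev, sq_nonneg (z 0), sq_nonneg (z 1), sq_nonneg (z 3)]) (by norm_num))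
  have hb3 : |z 3| ≤ (48 : ℝ) :=
    abs_le.2 (abs_le_of_sq_le_sq' (by nlinarith [hball, hlev, sq_nonneg (z 0), sq_nonneg (z 1), sq_nonneg (z 2)]) (by norm_num))
  refine (pi_norm_le_iff_of_nonneg (by norm_num)).2 fun i ↦ ?_
  rw [Real.norm_eq_abs]
  fin_cases i
  · simpa using hb0
  · simpa using hb1
  · simpa using hb2
  · simpa using hb3

/-! ### Calculus along a solution of the recast system (generic route: `Lyapunov/PolyRecast.lean`) -/

/-- The certificate's `Vdot` polynomial IS the kernel Lie derivative of `V` along `f`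
(model-1's `SOS.Poly.lieDeriv`; one `decide`, term order immaterial). [folklore] -/
theorem deg2_A_q13_Vdot_isLieDeriv :
    Poly.isZero (Poly.add deg2_A_q13_Vdot_poly (Poly.neg (Poly.lieDeriv [deg2_A_q13_f_rho_0_poly, deg2_A_q13_f_rho_1_poly, deg2_A_q13_f_xi_poly, deg2_A_q13_f_zeta_poly] deg2_A_q13_V_poly))) = true := by
  decide +kernel

/-- Coordinatewise form of a solution of the recast system, in the `PolyRecast` vocabulary. [folklore] -/
theorem deg2_A_q13_hasDerivWithinAt_coord {z : ℝ → Fin 4 → ℝ} {t : ℝ} {s : Set ℝ}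
    (hz : HasDerivWithinAt z (deg2_A_q13_F (z t)) s t) (i : Fin 4) :
    HasDerivWithinAt (fun τ ↦ z τ i)
      (Poly.eval (vars (List.ofFn (z t))) ([deg2_A_q13_f_rho_0_poly, deg2_A_q13_f_rho_1_poly, deg2_A_q13_f_xi_poly, deg2_A_q13_f_zeta_poly].getD i [])) s t := by
  have h := (hasDerivWithinAt_pi.1 hz) i
  fin_cases i <;> simpa [deg2_A_q13_F, deg2_A_q13_f_rho_0, deg2_A_q13_f_rho_1, deg2_A_q13_f_xi, deg2_A_q13_f_zeta] using h

/-- **Chain rule**: along a curve with right derivative `F (z t)`, `V ∘ z` has derivative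
`LV (z t) = Vdot(z t)` (`PolyRecast.hasDerivWithinAt_eval_of_isZero`). [folklore] -/
theorem deg2_A_q13_hasDerivWithinAt_Vz {z : ℝ → Fin 4 → ℝ} {t : ℝ} {s : Set ℝ}
    (hz : HasDerivWithinAt z (deg2_A_q13_F (z t)) s t) :
    HasDerivWithinAt (deg2_A_q13_Vz ∘ z) (deg2_A_q13_LVz (z t)) s t := by
  have h := PolyRecast.hasDerivWithinAt_eval_of_isZero (by decide) deg2_A_q13_Vdot_isLieDeriv
    (deg2_A_q13_hasDerivWithinAt_coord hz)
  have e1 : deg2_A_q13_Vz ∘ z = fun τ ↦ Poly.eval (vars (List.ofFn (z τ))) deg2_A_q13_V_poly := by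
    funext τ; simp [deg2_A_q13_Vz, deg2_A_q13_V]
  have e2 : deg2_A_q13_LVz (z t) = Poly.eval (vars (List.ofFn (z t))) deg2_A_q13_Vdot_poly := by
    simp [deg2_A_q13_LVz, deg2_A_q13_Vdot]
  rw [e1, e2]
  exact h

/-! ### The ROA inclusion for the recast model -/

/-- **Track S roa (quotient coordinates)** — EXACTLY the hypothesis `hroa` of model-3's transport
`InverterDVOC.DvocNetwork.invariants_tendsto_of_quotient_roa` (`Models/InverterDVOCOrbitRoa.lean`).
MODELLED: the shifted rotation-quotient system `ẋ = G̃(x)` of the `N = 2` dVOC network «DVOC2-GCBD19-13»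
(vars `x = (ρ₀, ρ₁, ξ, ζ) − r⋆`; model-3 p467971 / model-4 instance-N2-13.json). CERTIFIED inputs:
the two kernel identities of the Bench file. STATEMENT: for every level `0 < γ ≤ c = 2247/1000` and
every curve `z` on `[0, ∞)` (continuous, right derivative `F (z t)`) that stays in
`M = {h̃ = 0} ∩ {ρ₀ ≥ 0} ∩ {ρ₁ ≥ 0}` for all `t ≥ 0` with `V(z 0) ≤ γ`: `V(z t) ≤ γ` for all `t ≥ 0`
and `z t → 0` (convergence of the invariants to the rest point `r⋆`, i.e. of the network state to
the rest ORBIT — model-3's corollary). Via `Lyapunov.certificate_invariance_tendsto_univ`. No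
sentence here says a converter or a grid is stable. [folklore] -/
theorem deg2_A_q13_roa {γ : ℝ} (hγ0 : 0 < γ) (hγ : γ ≤ deg2_A_q13_level) :
    ∀ z : ℝ → Fin 4 → ℝ, ContinuousOn z (Ici 0) →
      (∀ t, 0 ≤ t → HasDerivWithinAt z (deg2_A_q13_F (z t)) (Ici t) t) → (∀ t, 0 ≤ t → z t ∈ deg2_A_q13_M) →
      deg2_A_q13_Vz (z 0) ≤ γ → (∀ t, 0 ≤ t → deg2_A_q13_Vz (z t) ≤ γ) ∧ Tendsto z atTop (𝓝 0) := by
  intro z hzc hz hzM h0V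
  have hF : Continuous deg2_A_q13_F := by
    refine continuous_pi fun i ↦ ?_
    fin_cases i <;> simp [deg2_A_q13_F, deg2_A_q13_f_rho_0_eq, deg2_A_q13_f_rho_1_eq, deg2_A_q13_f_xi_eq, deg2_A_q13_f_zeta_eq] <;> fun_prop
  have hV : Continuous deg2_A_q13_Vz := by unfold deg2_A_q13_Vz; simp only [deg2_A_q13_V_eq]; fun_prop
  have hW : Continuous deg2_A_q13_Wz := by unfold deg2_A_q13_Wz; fun_prop
  have h0 : (0 : Fin 4 → ℝ) ∈ deg2_A_q13_M := by
    refine ⟨by simp [deg2_A_q13_h_eq], by simp, by simp⟩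
  have hMc : IsClosed deg2_A_q13_M := deg2_A_q13_isClosed_M
  have hSγ : IsCompact {y ∈ deg2_A_q13_M | deg2_A_q13_Vz y ≤ γ} :=
    deg2_A_q13_isCompact_S.of_isClosed_subset (hMc.inter (isClosed_le hV continuous_const))
      (fun y hy ↦ ⟨hy.1, hy.2.trans hγ⟩)
  have h := certificate_invariance_tendsto_univ (M := deg2_A_q13_M) (LV := deg2_A_q13_LVz) (W := deg2_A_q13_Wz)
    (x₀ := 0) hSγ hF.continuousOn hV.continuousOn hW.continuousOn
    (fun y hy hVy ↦ deg2_A_q13_LVz_le hy (hVy.trans hγ))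
    (fun y _ _ ↦ by simp only [deg2_A_q13_Wz]; positivity)
    (fun y _ hVy ↦ deg2_A_q13_Wz_pos hγ0 hVy)
    h0 (by simp [deg2_A_q13_Vz, deg2_A_q13_V_eq]; exact hγ0.le) (by simp [deg2_A_q13_Wz])
    (fun y _ _ hWy ↦ deg2_A_q13_eq_zero_of_Wz hWy)
    hzc hz (fun t ht ↦ deg2_A_q13_hasDerivWithinAt_Vz (hz t ht)) hzM h0V
  exact ⟨fun t ht ↦ h.1 t ht, h.2⟩

end

end Summit.Ventures.GridStability.Bench.DVOC2GCBD19
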